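import Mathlib.Analysis.SpecialFunctions.Pow.NthRootLemmas
import Literature.Computability.Complexity.Williams2014
import HarnessLib

/-!
# Murray–Williams 2018, Theorem 1.3 (`NTIME[n^{polylog}] ⊄ AC⁰_d[m]`): the printed proof architecture

This file DECOMPOSES the named fact
`Literature.Computability.Complexity.MurrayWilliams2018_NTIME_not_depth_ACC`
(`CircuitLowerBounds.lean`; C. D. Murray, R. R. Williams, *Circuit lower bounds for
nondeterministic quasi-polytime: an easy witness lemma for NP and NQP*, STOC 2018, Thm. 1.3,
bottom threshold layer dropped) into the two theorems from which the source derives Theorem 1.3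
(§5: "Finally, to conclude lower bounds such as `NQP ⊄ ACC ∘ THR` (Theorem 1.3), we only have to
appeal to the `ACC ∘ THR`-SAT algorithm: Theorem 5.1"), vendored as named facts over the tree's
model, and PROVES the assembly step:

* `MurrayWilliams2018_thm_1_2_acc` — the *algorithms-to-lower-bounds connection for
  nondeterministic quasi-polynomial time* (Murray–Williams 2018, Thm. 1.2: "Let `C` be typical,
  and let `ε ∈ (0,1)`. Suppose `GAP C UNSAT` on `n`-input, `2^{n^ε}`-size circuits is in
  nondeterministic `O(2^{n - n^ε})` time. Then for all `k`, there is a `c ≥ 1` such that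
  `NTIME[2^{log^{ck⁴/ε} n}]` does not have `2^{log^k n}`-size `C`-circuits") for the classes
  `C = AC⁰[m]` of Thm. 1.3: if, for every depth, satisfiability of `n`-input `AC⁰[m]` circuits of
  size `2^{n^ε}` is decidable in time `O(2^{n - n^ε})` for some `ε = 1/r`, then for every `k`
  and `d` some language in `NTIME[n^{log^e n}]`, `e ≥ 1`, has no depth-`d`, `2^{(log₂ n)^k}`-size
  `AC⁰[m]` circuit family;
* `MurrayWilliams2018_thm_5_1` — the *`ACC`-SAT algorithm for subexponential size*
  (Murray–Williams 2018, Thm. 5.1, quoted there from Williams, STOC 2014; for circuits without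
  threshold gates it is Williams, J. ACM 2014, Thm. 4.1): for all `d` and `m ≥ 2` there is an
  `ε = 1/r ∈ (0,1)` such that satisfiability of depth-`d` `AC⁰[m]` circuits with `n` inputs and
  size `2^{n^ε}` is decidable in deterministic time `O(2^{n - n^ε})`;
* `MurrayWilliams2018_NTIME_not_depth_ACC_of_components` — **proved**: the two facts imply
  `MurrayWilliams2018_NTIME_not_depth_ACC` (sizes `c · n^{(log₂ n)^k} + c` are at most
  `4c · 2^{(log₂ n)^{k+2}} + 4c`, `pow_pow_log_le_two_pow_pow_log_add`, and `DepthSizeClass` is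
  monotone in the size bound, `DepthSizeClass_mono`).

Both facts are phrased with ONE predicate, `AccSatSubexp d m r :=
AccSatInTime d m (2 ^ ⌊n^{1/r}⌋) (2 ^ (n - ⌊n^{1/r}⌋))`, built on `AccSatInTime` of
`Williams2014.lean` (some `TM2` machine decides satisfiability of every `accBasis m`-circuit of
`acDepth ≤ d` with at most `s n` gates and fan-in `≤ s n`, presented as `encodeAccCircuit m C`,
within `c * T n + c` steps). The real exponent `ε ∈ (0,1)` is realised over the cofinal family
`ε = 1/r`, `r ≥ 2`, with Mathlib's integer root `Nat.nthRoot r n = ⌊n^{1/r}⌋` (the convention of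
`NSUBEXP`, `NSubexp.lean`); `AccSatSubexp.of_root_le` records that a larger `r` (smaller `ε`) is
the weaker assertion, so `∃ r ≥ 2` renders the printed `∃ ε ∈ (0,1)` (given `ε`, any integer
`r > 1/ε` will do; given `r`, `ε = 1/r`).

## Faithfulness notes

* Thm. 1.2 is printed for a *typical* class `C` (§2: evaluatable, closed under negations and
  under conjunctions; `ACC` is listed as typical) with ONE nondeterministic `GAP C UNSAT`
  algorithm. For the fixed-depth classes of Thm. 1.3 the printed proof (§5, proof of Thm. 1.1
  and its modification for Thm. 1.2) runs that algorithm only on the circuits `D` and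
  `E(C_n^O, W_n, ·, s)` assembled from a guessed depth-`d` `C`-circuit `E` for the polynomial-time
  problem EVAL-GATE by projections, negations, conjunctions and width-3 CNFs — `AC⁰[m]` circuits
  of depth `d + O(1)` over the same modulus `m`. We therefore assume a SAT algorithm for every
  depth `d'` over the modulus `m`, each depth with its own `ε` (the form Thm. 5.1 provides and
  the derivation of Thm. 1.3 uses) — the same adaptation as in `Williams2014_lowerBound_of_accSat`,
  where Williams' algorithm may depend on `(d, m, c)`. A deterministic SAT algorithm decides
  `GAP C UNSAT` nondeterministically a fortiori (answer *yes* iff the circuit is unsatisfiable,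
  never *don't know*), so the hypothesis here is stronger, and the fact weaker, than printed.
* The conclusion of Thm. 1.2 is stated with the time bound `n ^ (log₂ n) ^ e` of Thm. 1.3
  rather than `2 ^ (log₂ n) ^ e` ("all logarithms are base-2 with ceilings as appropriate", §2,
  so that `2^{log^{e+1} n} = n^{log^e n}` in the source — this is how Thm. 1.3 is read off from
  Thm. 1.2 there; over the tree's verifier-form `NTIME`, whose monotonicity in the time bound is
  itself a machine construction, `NTIME_mono`, we vendor that reading), with the exponent `e ≥ 1`
  integral and existential in place of the explicit `ck⁴/ε` (implied: enlarge the exponent), and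
  with the size bound in the arithmetic `O`-form `c * 2 ^ (log₂ n) ^ k + c` for every `c` (the
  idiom of `MurrayWilliams2018_NTIME_not_depth_ACC`: `DepthSizeClass` imposes its bound at every
  length `n`, and since the statement is for all `k`, the `O`-form at `k` is the bare bound at
  `k + 1` up to finitely many lengths).
* Sizes: the source measures unrestricted circuits by fan-in-two gates and `ACC` circuits by
  wires (Williams 2014, §2: "the distinction between the number of wires and gates does not
  matter"); `AccSatInTime` bounds gates AND fan-in by `2^{⌊n^{1/r}⌋}`, hence wires by the square
  `≤ 2^{2 n^{1/r}}`; with `r` existential on both sides this is again the printed statement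
  (replace `ε` by `ε/2`; the finitely many small `n` where `2 n^{ε/2} > n^ε` are finitely many
  instances, answered by table lookup inside the additive constant of the time bound).
* Thm. 5.1 is quoted in the source from Williams (STOC 2014) WITH up to `2^{n^ε}` linear
  threshold gates at the bottom; the tree's `accBasis m` has no threshold gates, and for such
  circuits the statement is already Williams, J. ACM 61 (2014), Thm. 4.1: "For every `d > 1`
  there is an `ε ∈ (0,1)` such that satisfiability of depth-`d` `ACC` circuits with `n` inputs
  and `2^{n^ε}` size can be determined in `2^{n - Ω(n^δ)}` time for some `δ > ε` that depends
  only on `d`" (`ACC` there having a fixed constant modulus, on which the constants of the `SYM⁺`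
  translation, Lemma 4.1, depend; `2^{n - Ω(n^δ)} = O(2^{n - n^ε})` as `δ > ε`), implemented on a
  multitape machine in Appendix C there ("The dynamic programming algorithm on a multitape TM");
  Mathlib's multi-stack `TM2` simulates a tape by two stacks step for step.
* Time bounds are the arithmetic `O`-form `c * T n + c` of `AccSatInTime`, with
  `T n = 2 ^ (n - ⌊n^{1/r}⌋)` in natural subtraction (`⌊n^{1/r}⌋ ≤ n`,
  `PolyExistsNTIME.nthRoot_le_self` of `PolyExistsNTIMEArith.lean`, so nothing is truncated).

## The rest of the printed proof (recorded for the further decomposition)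

Thm. 1.2 rests on: the new easy witness lemma for `NQP` (Lemma 1.3, full form Lemma 4.1, via
the "almost almost-everywhere" `MA/O(log n)` circuit lower bound Thm. 1.4/Thm. 3.1, Santhanam's
checkable `PSPACE`-complete language after Trevisan–Vadhan, Thm. 2.2–2.3, and Umans' generator,
Thm. 2.1); the PCP of Ben-Sasson–Viola (ICALP 2014) with `log₂ T + O(log log T)` random bits and
projection queries; the nondeterministic time hierarchy with unary witness languages
(Seiferas–Fischer–Meyer 1978, Žák 1983; the tree's `ntime_hierarchy` is the Arora–Barak form);
`P ⊆ NTIME[n^{log n}]` for EVAL-GATE; and the consistency circuit `D` of §5. Thm. 5.1 rests on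
the `SYM⁺` representation of `ACC` (Yao 1990, Beigel–Tarui 1994, Allender–Gore 1994;
`SymPlus.lean`) and Williams' evaluation lemma (J. ACM 2014, Lemma 4.2, Appendix C). Witness
circuits for `NTIME[t]` verifiers exist in the tree (`NVerifier`, `HasUniversalWitnessCircuits`,
`Williams2014Transfer.lean`); PCP verifiers with oracle circuits and Merlin–Arthur protocols with
advice do not, and are left to the files that attack the two facts.

## References

* C. D. Murray, R. R. Williams, *Circuit lower bounds for nondeterministic quasi-polytime: an
  easy witness lemma for NP and NQP*, STOC 2018, 890–901 (ECCC TR17-188; SIAM J. Comput. 49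
  (2020)), Thms. 1.1–1.3, §2 (typical classes), §5 (proofs of Thms. 1.1, 1.2, Thm. 5.1)
  [MurrayWilliams2018].
* R. Williams, *Nonuniform ACC circuit lower bounds*, J. ACM 61(1) (2014) 2:1–2:32, §2 ("On the
  machine model", sizes), Thm. 4.1, Lemma 4.1–4.2, Appendix C [Williams2014].
* R. Williams, *New algorithms and lower bounds for circuits with linear threshold gates*,
  STOC 2014, 194–202 (the `ACC ∘ THR` version quoted as Thm. 5.1).
* V. Kabanets, R. Impagliazzo, *Derandomizing polynomial identity tests means proving circuit
  lower bounds*, Comput. Complexity 13 (2004), §2.1 (`ε = 1/r` convention of `NSUBEXP`).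
-/

namespace Literature.Computability.Complexity

open Classes

/-! ### `AC⁰[m]`-SAT for subexponential size in time `2^{n - n^ε}`, `ε = 1/r` -/

/-- `AccSatSubexp d m r`: *satisfiability of depth-`d` `AC⁰[m]` circuits with `n` inputs and
size `2^{n^{1/r}}` is decidable in deterministic time `O(2^{n - n^{1/r}})`* — the hypothesis of
Murray–Williams 2018, Thm. 1.2 ("`GAP C UNSAT` on `n`-input, `2^{n^ε}`-size circuits is in
nondeterministic `O(2^{n−n^ε})` time", here for deterministic exact SAT, which is stronger) and
the conclusion of Thm. 5.1 there, at `ε = 1/r`, over the tree's `AccSatInTime`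
(`Williams2014.lean`): some `TM2` machine, given `encodeAccCircuit m C` for a circuit `C` on
`Fin n` over `accBasis m` with `acDepth C ≤ d`, at most `2 ^ ⌊n^{1/r}⌋` gates and fan-in
`≤ 2 ^ ⌊n^{1/r}⌋` (`Nat.nthRoot r n = ⌊n^{1/r}⌋`), outputs whether `C` is satisfiable within
`c * 2 ^ (n - ⌊n^{1/r}⌋) + c` steps. [cite: MurrayWilliams2018, Thm. 1.2 and Thm. 5.1] -/
def AccSatSubexp (d m r : ℕ) : Prop :=
  AccSatInTime d m (fun n => 2 ^ Nat.nthRoot r n) (fun n => 2 ^ (n - Nat.nthRoot r n))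

/-- Unfolding of `AccSatSubexp` (definitional). [folklore] -/
theorem accSatSubexp_iff (d m r : ℕ) :
    AccSatSubexp d m r ↔
      AccSatInTime d m (fun n => 2 ^ Nat.nthRoot r n) (fun n => 2 ^ (n - Nat.nthRoot r n)) :=
  Iff.rfl

/-- The integer root is antitone in the index on `r ≥ 1`: `⌊n^{1/r'}⌋ ≤ ⌊n^{1/r}⌋` for
`1 ≤ r ≤ r'`. [folklore] -/
theorem nthRoot_anti_left {r r' : ℕ} (hr : r ≠ 0) (hrr' : r ≤ r') (n : ℕ) :
    Nat.nthRoot r' n ≤ Nat.nthRoot r n := by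
  have hr' : r' ≠ 0 := by omega
  rw [Nat.le_nthRoot_iff hr]
  rcases Nat.eq_zero_or_pos (Nat.nthRoot r' n) with h0 | hpos
  · rw [h0, zero_pow hr]; exact Nat.zero_le _
  · calc Nat.nthRoot r' n ^ r ≤ Nat.nthRoot r' n ^ r' := Nat.pow_le_pow_right hpos hrr'
      _ ≤ n := Nat.pow_nthRoot_le (Or.inl hr')

/-- Monotonicity of `AccSatInTime` in the depth bound (fewer instances). [folklore] -/
theorem AccSatInTime.anti_depth {d d' m : ℕ} {s T : ℕ → ℕ} (h : AccSatInTime d m s T)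
    (hd : d' ≤ d) : AccSatInTime d' m s T := by
  obtain ⟨c, M, hM⟩ := h
  exact ⟨c, M, fun n C hO hdep hsz hf => hM n C hO (hdep.trans hd) hsz hf⟩

/-- **Smaller `ε` is weaker**: an algorithm for size `2^{n^{1/r}}` in time `O(2^{n - n^{1/r}})`
is one for size `2^{n^{1/r'}}` in time `O(2^{n - n^{1/r'}})` whenever `1 ≤ r ≤ r'` (fewer
instances, more time). Hence `∃ r ≥ 2, AccSatSubexp d m r` is the printed "for some
`ε ∈ (0,1)`" (Murray–Williams 2018, Thm. 1.2/Thm. 5.1). [folklore] -/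
theorem AccSatSubexp.of_root_le {d m r r' : ℕ} (h : AccSatSubexp d m r) (hr : r ≠ 0)
    (hrr' : r ≤ r') : AccSatSubexp d m r' := by
  have hroot : ∀ n, Nat.nthRoot r' n ≤ Nat.nthRoot r n := nthRoot_anti_left hr hrr'
  have h1 : AccSatSubexp d m r = AccSatInTime d m (fun n => 2 ^ Nat.nthRoot r n)
      (fun n => 2 ^ (n - Nat.nthRoot r n)) := rfl
  rw [h1] at h
  have h2 := h.anti_size (s' := fun n => 2 ^ Nat.nthRoot r' n)
    (fun n => Nat.pow_le_pow_right two_pos (hroot n))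
  exact h2.of_le_of_bdd 0 0
    (fun n _ => Nat.pow_le_pow_right two_pos (Nat.sub_le_sub_left (hroot n) n))
    (fun n hn => absurd hn (Nat.not_lt_zero n))

/-- Monotonicity of `AccSatSubexp` in the depth (fewer instances). [folklore] -/
theorem AccSatSubexp.anti_depth {d d' m r : ℕ} (h : AccSatSubexp d m r) (hd : d' ≤ d) :
    AccSatSubexp d' m r :=
  AccSatInTime.anti_depth h hd

/-! ### Murray–Williams 2018, Thm. 1.2 (for `AC⁰[m]`) and Thm. 5.1 as named facts -/

/-- **Murray–Williams' algorithms-to-lower-bounds connection for `NQP`, for the classes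
`AC⁰[m]`** (Murray–Williams 2018, Thm. 1.2: "Let `C` be typical, and let `ε ∈ (0,1)`. Suppose
`GAP C UNSAT` on `n`-input, `2^{n^ε}`-size circuits is in nondeterministic `O(2^{n−n^ε})` time.
Then for all `k`, there is a `c ≥ 1` such that `NTIME[2^{log^{ck⁴/ε} n}]` does not have
`2^{log^k n}`-size `C`-circuits"; proved in §5 from the easy witness lemma for `NQP`, Lemma 4.1,
the Ben-Sasson–Viola PCP and the nondeterministic time hierarchy), in the form in which §5
derives Thm. 1.3 from it: for a modulus `m ≥ 2` and a depth `d`, IF for every depth `d'` there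
is an `r ≥ 2` (`ε = 1/r`) such that satisfiability of depth-`d'` `AC⁰[m]` circuits with `n`
inputs and at most `2^{⌊n^{1/r}⌋}` gates and fan-in is decidable in deterministic time
`O(2^{n - ⌊n^{1/r}⌋})` (`AccSatSubexp d' m r`; the printed proof runs the algorithm only in depth
`d + O(1)` over the modulus `m`, and a deterministic SAT algorithm is a nondeterministic
`GAP UNSAT` algorithm), THEN for every `k` there are an `e ≥ 1` and a language in
`NTIME (n ^ (log₂ n) ^ e)` that, for no constant `c`, is decided by a depth-`d` `AC⁰[m]` circuit
family of size `c * 2 ^ (log₂ n) ^ k + c` (`log₂ = Nat.log 2`; time bound read as in Thm. 1.3,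
`2^{log^{e+1} n} = n^{log^e n}`, sizes in the arithmetic `O`-form of `DepthSizeClass` bounds; see
the module docstring for why each deviation is implied by the printed theorem and its proof).
[cite: MurrayWilliams2018, Thm. 1.2] -/
def MurrayWilliams2018_thm_1_2_acc : Prop :=
  ∀ (d m : ℕ), 2 ≤ m → (∀ d' : ℕ, ∃ r : ℕ, 2 ≤ r ∧ AccSatSubexp d' m r) →
    ∀ k : ℕ, ∃ e : ℕ, 1 ≤ e ∧ ∃ L ∈ NTIME (fun n => n ^ (Nat.log 2 n) ^ e),
      ∀ c : ℕ,
        L ∉ DepthSizeClass (accBasis m) (fun _ => d) (fun n => c * 2 ^ (Nat.log 2 n) ^ k + c)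

/-- **The `ACC`-SAT algorithm for subexponential size** (Murray–Williams 2018, Thm. 5.1, quoted
from Williams, STOC 2014: "For all integers `d` and `m ≥ 2`, there is an `ε > 0` and an
`O(2^{n−n^ε})`-time deterministic algorithm for the satisfiability problem on depth-`d`
size-`2^{n^ε}` circuits over unbounded fan-in AND, OR, and MODm gates, with linear threshold
gates at the bottom layer"; for circuits WITHOUT threshold gates — the case of the tree's
`accBasis m` — this is Williams, J. ACM 2014, Thm. 4.1: depth-`d` `ACC` circuits with `n` inputs
and `2^{n^ε}` size in `2^{n - Ω(n^δ)}` time, `δ > ε`, on a multitape machine, Appendix C).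
Over the tree's model, with `ε = 1/r`: for all `d` and `m ≥ 2` there is an `r ≥ 2` such that some
`TM2` machine decides satisfiability of every depth-`d` `accBasis m`-circuit with `n` inputs, at
most `2^{⌊n^{1/r}⌋}` gates and fan-in `≤ 2^{⌊n^{1/r}⌋}`, presented as `encodeAccCircuit m C`,
within `c * 2 ^ (n - ⌊n^{1/r}⌋) + c` steps (`AccSatSubexp`; gates-and-fan-in versus wires and
`1/r` versus `ε` only shrink `ε`, see the module docstring). [cite: MurrayWilliams2018, Thm. 5.1] -/
def MurrayWilliams2018_thm_5_1 : Prop :=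
  ∀ (d m : ℕ), 2 ≤ m → ∃ r : ℕ, 2 ≤ r ∧ AccSatSubexp d m r

/-! ### Assembly: Theorem 1.3 from Theorem 1.2 and Theorem 5.1 -/

/-- `n ^ (log₂ n) ^ k ≤ 2 ^ (log₂ n) ^ (k + 2) + 3`: for `n ≥ 4`, with `L = log₂ n ≥ 2`, one has
`n < 2 ^ (L + 1)` and `(L + 1) Lᵏ ≤ L^{k+2}`; for `n ≤ 3` the left-hand side is at most `3`.
(The comparison `n^{log^k n} ≤ 2^{log^{k+2} n}` behind reading Thm. 1.3 off Thm. 1.2.)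
[folklore] -/
theorem pow_pow_log_le_two_pow_pow_log_add (k n : ℕ) :
    n ^ (Nat.log 2 n) ^ k ≤ 2 ^ (Nat.log 2 n) ^ (k + 2) + 3 := by
  set L := Nat.log 2 n with hL
  rcases lt_or_ge n 4 with hn | hn
  · -- `n ≤ 3`, `L ≤ 1`
    have hL1 : L ≤ 1 :=
      Nat.lt_succ_iff.mp (Nat.log_lt_of_lt_pow' two_ne_zero (by norm_num; omega))
    have hLk : L ^ k ≤ 1 := by
      calc L ^ k ≤ 1 ^ k := Nat.pow_le_pow_left hL1 k
        _ = 1 := one_pow k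
    calc n ^ L ^ k ≤ 3 := by
          rcases Nat.eq_zero_or_pos (L ^ k) with h0 | hpos
          · rw [h0, pow_zero]; omega
          · have h1 : L ^ k = 1 := le_antisymm hLk hpos
            rw [h1, pow_one]; omega
      _ ≤ 2 ^ L ^ (k + 2) + 3 := Nat.le_add_left 3 _
  · -- `n ≥ 4`, `L ≥ 2`
    have hn0 : n ≠ 0 := by omega
    have hL2 : 2 ≤ L := (Nat.le_log_iff_pow_le one_lt_two hn0).mpr (by simpa using hn)
    have hlt : n < 2 ^ (L + 1) := Nat.lt_pow_succ_log_self one_lt_two n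
    have hexp : (L + 1) * L ^ k ≤ L ^ (k + 2) := by
      have h1 : L + 1 ≤ L * L := by nlinarith
      calc (L + 1) * L ^ k ≤ (L * L) * L ^ k := Nat.mul_le_mul_right _ h1
        _ = L ^ (k + 2) := by ring
    calc n ^ L ^ k ≤ (2 ^ (L + 1)) ^ L ^ k := Nat.pow_le_pow_left hlt.le _
      _ = 2 ^ ((L + 1) * L ^ k) := by rw [← pow_mul]
      _ ≤ 2 ^ L ^ (k + 2) := Nat.pow_le_pow_right two_pos hexp
      _ ≤ 2 ^ L ^ (k + 2) + 3 := Nat.le_add_right _ _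

/-- The size bound `c * n ^ (log₂ n) ^ k + c` of `MurrayWilliams2018_NTIME_not_depth_ACC` is
dominated, at every length, by the bound `4c * 2 ^ (log₂ n) ^ (k + 2) + 4c` of
`MurrayWilliams2018_thm_1_2_acc` at `k + 2`. [folklore] -/
theorem mul_pow_pow_log_add_le (c k n : ℕ) :
    c * n ^ (Nat.log 2 n) ^ k + c ≤ 4 * c * 2 ^ (Nat.log 2 n) ^ (k + 2) + 4 * c := by
  have h := pow_pow_log_le_two_pow_pow_log_add k n
  calc c * n ^ (Nat.log 2 n) ^ k + c ≤ c * (2 ^ (Nat.log 2 n) ^ (k + 2) + 3) + c :=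
        Nat.add_le_add_right (Nat.mul_le_mul_left c h) c
    _ = c * 2 ^ (Nat.log 2 n) ^ (k + 2) + 4 * c := by ring
    _ ≤ 4 * c * 2 ^ (Nat.log 2 n) ^ (k + 2) + 4 * c := by
        refine Nat.add_le_add_right ?_ _
        calc c * 2 ^ (Nat.log 2 n) ^ (k + 2) = 1 * (c * 2 ^ (Nat.log 2 n) ^ (k + 2)) :=
              (one_mul _).symm
          _ ≤ 4 * (c * 2 ^ (Nat.log 2 n) ^ (k + 2)) := Nat.mul_le_mul_right _ (by norm_num)
          _ = 4 * c * 2 ^ (Nat.log 2 n) ^ (k + 2) := by ring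

/-- **Assembly of Murray–Williams' Theorem 1.3 (threshold-free) from its printed components**:
the connection Thm. 1.2 for `AC⁰[m]` (`MurrayWilliams2018_thm_1_2_acc`) and the `ACC`-SAT
algorithm Thm. 5.1 (`MurrayWilliams2018_thm_5_1`) imply
`MurrayWilliams2018_NTIME_not_depth_ACC`: for all `k`, `d`, `m ≥ 2` some language in
`NTIME (n ^ (log₂ n) ^ e)`, `e ≥ 1`, has no depth-`d` `AC⁰[m]` circuit family of size
`c * n ^ (log₂ n) ^ k + c` for any `c` (Murray–Williams 2018, §5: "to conclude lower bounds such
as `NQP ⊄ ACC ∘ THR` (Theorem 1.3), we only have to appeal to the `ACC ∘ THR`-SAT algorithm";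
the hard language of Thm. 1.2 at exponent `k + 2` works, as
`c · n^{(log₂ n)^k} + c ≤ 4c · 2^{(log₂ n)^{k+2}} + 4c` and `DepthSizeClass` is monotone in the
size bound). [cite: MurrayWilliams2018, Thm. 1.3 (proof, §5)] -/
theorem MurrayWilliams2018_NTIME_not_depth_ACC_of_components
    (h12 : MurrayWilliams2018_thm_1_2_acc) (h51 : MurrayWilliams2018_thm_5_1) :
    MurrayWilliams2018_NTIME_not_depth_ACC := by
  intro k d m hm
  obtain ⟨e, he, L, hL, hnot⟩ := h12 d m hm (fun d' => h51 d' m hm) (k + 2)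
  refine ⟨e, he, L, hL, fun c hc => hnot (4 * c) ?_⟩
  exact DepthSizeClass_mono le_rfl (fun _ => le_rfl) (fun n => mul_pow_pow_log_add_le c k n) hc

/-! ### The converse: Theorem 1.3 implies the conditional Theorem 1.2 (for `AC⁰[m]`) outright -/

/-- The size bound `c * 2 ^ (log₂ n) ^ k + c` of `MurrayWilliams2018_thm_1_2_acc` is dominated,
at every length, by the bound `3c * n ^ (log₂ n) ^ k + 3c` of
`MurrayWilliams2018_NTIME_not_depth_ACC` at the same `k`: for `n ≥ 2` one has
`2 ^ (log₂ n) ^ k ≤ n ^ (log₂ n) ^ k`, and for `n ≤ 1` the left-hand side is at most `3c`.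
[folklore] -/
theorem mul_two_pow_pow_log_add_le (c k n : ℕ) :
    c * 2 ^ (Nat.log 2 n) ^ k + c ≤ 3 * c * n ^ (Nat.log 2 n) ^ k + 3 * c := by
  rcases lt_or_ge n 2 with hn | hn
  · -- `n ≤ 1`: `log₂ n = 0`, so `2 ^ 0 ^ k ≤ 2`
    have hL : Nat.log 2 n = 0 := Nat.log_of_lt hn
    have h2 : 2 ^ (Nat.log 2 n) ^ k ≤ 2 := by
      rw [hL]
      rcases Nat.eq_zero_or_pos k with rfl | hk
      · simp
      · rw [zero_pow hk.ne', pow_zero]; omega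
    calc c * 2 ^ (Nat.log 2 n) ^ k + c ≤ c * 2 + c :=
          Nat.add_le_add_right (Nat.mul_le_mul_left c h2) c
      _ = 3 * c := by ring
      _ ≤ 3 * c * n ^ (Nat.log 2 n) ^ k + 3 * c := Nat.le_add_left _ _
  · -- `n ≥ 2`: compare the bases
    have h2 : 2 ^ (Nat.log 2 n) ^ k ≤ n ^ (Nat.log 2 n) ^ k := Nat.pow_le_pow_left hn _
    calc c * 2 ^ (Nat.log 2 n) ^ k + c ≤ c * n ^ (Nat.log 2 n) ^ k + c :=
          Nat.add_le_add_right (Nat.mul_le_mul_left c h2) c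
      _ ≤ 3 * c * n ^ (Nat.log 2 n) ^ k + 3 * c := by
          refine Nat.add_le_add ?_ (by omega)
          calc c * n ^ (Nat.log 2 n) ^ k = 1 * (c * n ^ (Nat.log 2 n) ^ k) := (one_mul _).symm
            _ ≤ 3 * (c * n ^ (Nat.log 2 n) ^ k) := Nat.mul_le_mul_right _ (by norm_num)
            _ = 3 * c * n ^ (Nat.log 2 n) ^ k := by ring

/-- **Theorem 1.3 implies the `AC⁰[m]` form of Theorem 1.2 outright.** The named fact
`MurrayWilliams2018_thm_1_2_acc` is an implication whose conclusion — for the given depth `d`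
and modulus `m`, for every `k` a language in some `NTIME (n ^ (log₂ n) ^ e)`, `e ≥ 1`, without
depth-`d` `AC⁰[m]` circuit families of size `c * 2 ^ (log₂ n) ^ k + c` — is, up to the
comparison of size bounds `mul_two_pow_pow_log_add_le` and the monotonicity of `DepthSizeClass`
in the size bound, the content of Theorem 1.3 (`MurrayWilliams2018_NTIME_not_depth_ACC`) at the
same `(k, d, m)`; its `AC⁰[m]`-SAT hypothesis is then not needed. Together with
`MurrayWilliams2018_NTIME_not_depth_ACC_of_components` this records that, GIVEN Theorem 5.1
(`MurrayWilliams2018_thm_5_1`), the two named facts are equivalent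
(`MurrayWilliams2018_thm_1_2_acc_iff_NTIME_not_depth_ACC`): the decomposition of Theorem 1.3
into Theorems 1.2 and 5.1 follows the source (§5, p. 16) but isolates only Theorem 5.1 as a
separate obligation — the whole difficulty of Theorem 1.3 beyond the SAT algorithm (easy witness
lemma for `NQP`, Lemma 4.1; the PCP of Ben-Sasson–Viola; the simulation of §5) sits in
`MurrayWilliams2018_thm_1_2_acc`, and a discharge of either fact discharges the other.
[cite: MurrayWilliams2018, Thm. 1.2 and Thm. 1.3] -/
theorem MurrayWilliams2018_thm_1_2_acc_of_NTIME_not_depth_ACC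
    (h : MurrayWilliams2018_NTIME_not_depth_ACC) : MurrayWilliams2018_thm_1_2_acc := by
  intro d m hm _ k
  obtain ⟨e, he, L, hL, hnot⟩ := h k d m hm
  refine ⟨e, he, L, hL, fun c hc => hnot (3 * c) ?_⟩
  exact DepthSizeClass_mono le_rfl (fun _ => le_rfl) (fun n => mul_two_pow_pow_log_add_le c k n) hc

/-- **Given Theorem 5.1, the `AC⁰[m]` form of Theorem 1.2 and Theorem 1.3 are equivalent named
facts** (`MurrayWilliams2018_NTIME_not_depth_ACC_of_components` and
`MurrayWilliams2018_thm_1_2_acc_of_NTIME_not_depth_ACC`). [cite: MurrayWilliams2018, Thm. 1.2, Thm. 1.3 and Thm. 5.1 (§5)] -/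
theorem MurrayWilliams2018_thm_1_2_acc_iff_NTIME_not_depth_ACC
    (h51 : MurrayWilliams2018_thm_5_1) :
    MurrayWilliams2018_thm_1_2_acc ↔ MurrayWilliams2018_NTIME_not_depth_ACC :=
  ⟨fun h12 => MurrayWilliams2018_NTIME_not_depth_ACC_of_components h12 h51,
    MurrayWilliams2018_thm_1_2_acc_of_NTIME_not_depth_ACC⟩

end Literature.Computability.Complexity
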